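import Mathlib

/-!
# Route `FilamentSkeletonRss` · crux `TransverseReduction1AG` (stmt-NavierStokesRegularity-27853; A1L twin stmt-23297) · line
# `defect_column_gate_1AG/1AL` — two GENERIC one-variable tools for the two-zone scheme of the azimuthal blocks of S2a-loc
# `WaistColumnGateLoc1A`: layer averaging of a boundary flux, and axis-safe pointwise extraction from dissipation currencies

Helper file (`--supports stmt-NavierStokesRegularity-27853 --as helper`; seat ns-filament-s2aloc-p1 g2, MINT req187 no-hit branch; bricks (L) and (X)
of the seat's note ARCHITECTURE-B2B3-s2aloc-g2.md v2 §6, evidence on 27853 / 23297).  No project imports: pure real analysis.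

(L) `exists_mul_le_integral`: a continuous `g` on `[x, y]` takes, at some point of the interval, a value `≤` its average —
`∃ c ∈ [x,y], (y − x)·g(c) ≤ ∫_x^y g`.  In the scheme this picks the truncation point `u₁` of the Gaussian identities inside the layer
`[u₀, u₀ + 1/γ]` so that the boundary fluxes `E·4uJ`, `E·Y` at `u₁` are bounded by their layer averages (then by AM–GM against dissipation).
(X) `sq_le_extraction`: for `a, b` with derivatives `a₁, b₁` on `(u, 2u)`, `u > 0`, all continuous on `[u, 2u]`:
`a(u)² + b(u)² ≤ 3∫_u^{2u} (a²+b²)/v dv + ∫_u^{2u} v(a₁² + b₁²) dv` — the sup of the modulus is extracted from the two DISSIPATION currencies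
of the Gaussian real-part identity (`∫E m²s/u` and `∫E·4u|w′|²`) with no `1/u` degeneration at the axis and no Sobolev embedding (minimum point +
FTC + AM–GM `|s′| ≤ s/v + v|w′|²`).
HONEST FRAMING: elementary lemmas serving ONE family of blocks of ONE linear MODEL operator of a hypothetical blow-up route (MODEL rung, negative
side); nothing here bears on Navier–Stokes regularity.
-/

set_option linter.dupNamespace false

noncomputable section

namespace Summit.NavierStokesRegularity.NavierStokesRegularity.Theorems.DefectColumnGate

open scoped Topology
open Set Filter MeasureTheory intervalIntegral

/-! ## (L) Layer averaging -/

/-- **A continuous function is somewhere at most its average.**  `g` continuous on `[x, y]`, `x ≤ y`: there is `c ∈ [x, y]` with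
`(y − x)·g(c) ≤ ∫_x^y g` (take a minimum point). -/
theorem exists_mul_le_integral {x y : ℝ} {g : ℝ → ℝ} (hxy : x ≤ y) (hg : ContinuousOn g (Icc x y)) :
    ∃ c ∈ Icc x y, (y - x) * g c ≤ ∫ u in x..y, g u := by
  obtain ⟨c, hc, hmin⟩ := (isCompact_Icc : IsCompact (Icc x y)).exists_isMinOn (nonempty_Icc.2 hxy) hg
  refine ⟨c, hc, ?_⟩
  have hconst : ∫ _ in x..y, g c = (y - x) * g c := by
    rw [intervalIntegral.integral_const, smul_eq_mul]
  rw [← hconst]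
  apply integral_mono_on hxy
  · exact _root_.intervalIntegrable_const
  · exact hg.intervalIntegrable_of_Icc hxy
  · intro u hu; exact hmin hu

/-! ## (X) Axis-safe extraction -/

/-- **Pointwise extraction of the modulus from the dissipation currencies.**  `u > 0`; `a, b, a₁, b₁` continuous on `[u, 2u]` with
`a′ = a₁`, `b′ = b₁` on `(u, 2u)`.  Then `a(u)² + b(u)² ≤ 3∫_u^{2u}(a² + b²)/v dv + ∫_u^{2u} v(a₁² + b₁²) dv`. -/
theorem sq_le_extraction {u : ℝ} {a a₁ b b₁ : ℝ → ℝ} (hu : 0 < u)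
    (ha : ContinuousOn a (Icc u (2 * u))) (hb : ContinuousOn b (Icc u (2 * u)))
    (ha₁ : ContinuousOn a₁ (Icc u (2 * u))) (hb₁ : ContinuousOn b₁ (Icc u (2 * u)))
    (hdera : ∀ v ∈ Ioo u (2 * u), HasDerivAt a (a₁ v) v) (hderb : ∀ v ∈ Ioo u (2 * u), HasDerivAt b (b₁ v) v) :
    a u ^ 2 + b u ^ 2
      ≤ 3 * (∫ v in u..(2 * u), (a v ^ 2 + b v ^ 2) / v) + ∫ v in u..(2 * u), v * (a₁ v ^ 2 + b₁ v ^ 2) := by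
  have hu2 : u ≤ 2 * u := by linarith
  set s : ℝ → ℝ := fun v => a v ^ 2 + b v ^ 2 with hsdef
  set s₁ : ℝ → ℝ := fun v => 2 * (a v * a₁ v + b v * b₁ v) with hs₁def
  have hs : ContinuousOn s (Icc u (2 * u)) := (ha.pow 2).add (hb.pow 2)
  have hs₁ : ContinuousOn s₁ (Icc u (2 * u)) := ((ha.mul ha₁).add (hb.mul hb₁)).const_smul (2:ℝ) |>.congr
    (fun v _ => by simp [hs₁def, smul_eq_mul])
  have hders : ∀ v ∈ Ioo u (2 * u), HasDerivAt s (s₁ v) v := by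
    intro v hv
    have h := ((hdera v hv).fun_pow 2).add ((hderb v hv).fun_pow 2)
    exact h.congr_deriv (by simp [hs₁def]; ring)
  -- continuity-based integrability on `[u, 2u]`
  have hpos : ∀ v ∈ Icc u (2 * u), 0 < v := fun v hv => lt_of_lt_of_le hu hv.1
  have hsv : ContinuousOn (fun v => s v / v) (Icc u (2 * u)) :=
    hs.div continuousOn_id (fun v hv => (hpos v hv).ne')
  have hdis : ContinuousOn (fun v => v * (a₁ v ^ 2 + b₁ v ^ 2)) (Icc u (2 * u)) :=
    continuousOn_id.mul ((ha₁.pow 2).add (hb₁.pow 2))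
  have hbound : ContinuousOn (fun v => s v / v + v * (a₁ v ^ 2 + b₁ v ^ 2)) (Icc u (2 * u)) := hsv.add hdis
  have hIs : IntervalIntegrable s volume u (2 * u) := hs.intervalIntegrable_of_Icc hu2
  have hIs₁ : IntervalIntegrable s₁ volume u (2 * u) := hs₁.intervalIntegrable_of_Icc hu2
  have hIsv : IntervalIntegrable (fun v => s v / v) volume u (2 * u) := hsv.intervalIntegrable_of_Icc hu2
  have hIdis : IntervalIntegrable (fun v => v * (a₁ v ^ 2 + b₁ v ^ 2)) volume u (2 * u) :=
    hdis.intervalIntegrable_of_Icc hu2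
  have hIbound : IntervalIntegrable (fun v => s v / v + v * (a₁ v ^ 2 + b₁ v ^ 2)) volume u (2 * u) :=
    hbound.intervalIntegrable_of_Icc hu2
  -- pointwise AM–GM: `|s′| ≤ s/v + v(a₁² + b₁²)` on `[u, 2u]`
  have hamgm : ∀ v ∈ Icc u (2 * u), |s₁ v| ≤ s v / v + v * (a₁ v ^ 2 + b₁ v ^ 2) := by
    intro v hv
    have hv0 : 0 < v := hpos v hv
    simp only [hs₁def, hsdef]
    rw [abs_le]
    constructor
    · have e : s v / v + v * (a₁ v ^ 2 + b₁ v ^ 2) + 2 * (a v * a₁ v + b v * b₁ v)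
          = ((a v + v * a₁ v) ^ 2 + (b v + v * b₁ v) ^ 2) / v := by
        simp only [hsdef]; field_simp; ring
      have : 0 ≤ ((a v + v * a₁ v) ^ 2 + (b v + v * b₁ v) ^ 2) / v := by positivity
      simp only [hsdef] at e
      linarith
    · have e : s v / v + v * (a₁ v ^ 2 + b₁ v ^ 2) - 2 * (a v * a₁ v + b v * b₁ v)
          = ((a v - v * a₁ v) ^ 2 + (b v - v * b₁ v) ^ 2) / v := by
        simp only [hsdef]; field_simp; ring
      have : 0 ≤ ((a v - v * a₁ v) ^ 2 + (b v - v * b₁ v) ^ 2) / v := by positivity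
      simp only [hsdef] at e
      linarith
  -- a minimum point `c` of `s` on `[u, 2u]`: `u·s(c) ≤ ∫ s ≤ 2u ∫ s/v`
  obtain ⟨c, hc, hcle⟩ := exists_mul_le_integral hu2 hs
  have hsc : s c ≤ 2 * ∫ v in u..(2 * u), s v / v := by
    have h1 : ∫ v in u..(2 * u), s v ≤ ∫ v in u..(2 * u), (2 * u) * (s v / v) := by
      apply integral_mono_on hu2 hIs (hIsv.const_mul _)
      intro v hv
      have hv0 : 0 < v := hpos v hv
      have hs0 : 0 ≤ s v := by simp only [hsdef]; positivity
      rw [mul_div_assoc', le_div_iff₀ hv0]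
      nlinarith [hv.2]
    rw [intervalIntegral.integral_const_mul] at h1
    have h2 : (2 * u - u) * s c = u * s c := by ring
    rw [h2] at hcle
    nlinarith [hcle, h1]
  -- FTC on `[u, c]`: `s(u) = s(c) − ∫_u^c s′ ≤ s(c) + ∫_u^{2u} |s′|`
  have hFTC : ∫ v in u..c, s₁ v = s c - s u := by
    apply integral_eq_sub_of_hasDerivAt_of_le hc.1 (hs.mono (Icc_subset_Icc le_rfl hc.2))
    · intro v hv; exact hders v ⟨hv.1, lt_of_lt_of_le hv.2 hc.2⟩
    · exact hIs₁.mono_set (by rw [uIcc_of_le hc.1, uIcc_of_le hu2]; exact Icc_subset_Icc le_rfl hc.2)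
  have habs : |∫ v in u..c, s₁ v| ≤ ∫ v in u..(2 * u), (s v / v + v * (a₁ v ^ 2 + b₁ v ^ 2)) := by
    calc |∫ v in u..c, s₁ v| ≤ ∫ v in u..c, |s₁ v| := abs_integral_le_integral_abs hc.1
      _ ≤ ∫ v in u..c, (s v / v + v * (a₁ v ^ 2 + b₁ v ^ 2)) := by
          apply integral_mono_on hc.1
          · exact (hIs₁.mono_set (by rw [uIcc_of_le hc.1, uIcc_of_le hu2]; exact Icc_subset_Icc le_rfl hc.2)).abs
          · exact hIbound.mono_set (by rw [uIcc_of_le hc.1, uIcc_of_le hu2]; exact Icc_subset_Icc le_rfl hc.2)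
          · intro v hv; exact hamgm v ⟨hv.1, le_trans hv.2 hc.2⟩
      _ ≤ ∫ v in u..(2 * u), (s v / v + v * (a₁ v ^ 2 + b₁ v ^ 2)) := by
          apply integral_mono_interval le_rfl hc.1 hc.2
          · refine MeasureTheory.ae_restrict_of_forall_mem measurableSet_Ioc (fun v hv => ?_)
            have hv0 : 0 < v := lt_trans hu hv.1
            have hs0 : 0 ≤ s v := by simp only [hsdef]; positivity
            positivity
          · exact hIbound
  have hsplit : ∫ v in u..(2 * u), (s v / v + v * (a₁ v ^ 2 + b₁ v ^ 2))
      = (∫ v in u..(2 * u), s v / v) + ∫ v in u..(2 * u), v * (a₁ v ^ 2 + b₁ v ^ 2) := integral_add hIsv hIdis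
  have hle : s u ≤ s c + ∫ v in u..(2 * u), (s v / v + v * (a₁ v ^ 2 + b₁ v ^ 2)) := by
    have := neg_abs_le (∫ v in u..c, s₁ v)
    linarith [hFTC, habs, this]
  have : s u ≤ 3 * (∫ v in u..(2 * u), s v / v) + ∫ v in u..(2 * u), v * (a₁ v ^ 2 + b₁ v ^ 2) := by
    rw [hsplit] at hle; linarith [hsc]
  simpa [hsdef] using this


/-! ## (X') APPENDED (same seat, same gen): extraction at ANY point of a dyadic interval -/

/-- **Pointwise extraction at any point of `[x, 2x]`.**  `x > 0`; `a, b, a₁, b₁` continuous on `[x, 2x]` with `a′ = a₁`, `b′ = b₁` on `(x, 2x)`;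
`z ∈ [x, 2x]`.  Then `a(z)² + b(z)² ≤ 3∫_x^{2x}(a² + b²)/v dv + ∫_x^{2x} v(a₁² + b₁²) dv` (so core points near the truncation radius `u₁` are
extracted from `[u₁/2, u₁]`, inside the core). -/
theorem sq_le_extraction_of_mem {x z : ℝ} {a a₁ b b₁ : ℝ → ℝ} (hx : 0 < x) (hz : z ∈ Icc x (2 * x))
    (ha : ContinuousOn a (Icc x (2 * x))) (hb : ContinuousOn b (Icc x (2 * x)))
    (ha₁ : ContinuousOn a₁ (Icc x (2 * x))) (hb₁ : ContinuousOn b₁ (Icc x (2 * x)))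
    (hdera : ∀ v ∈ Ioo x (2 * x), HasDerivAt a (a₁ v) v) (hderb : ∀ v ∈ Ioo x (2 * x), HasDerivAt b (b₁ v) v) :
    a z ^ 2 + b z ^ 2
      ≤ 3 * (∫ v in x..(2 * x), (a v ^ 2 + b v ^ 2) / v) + ∫ v in x..(2 * x), v * (a₁ v ^ 2 + b₁ v ^ 2) := by
  have hx2 : x ≤ 2 * x := by linarith
  set s : ℝ → ℝ := fun v => a v ^ 2 + b v ^ 2 with hsdef
  set s₁ : ℝ → ℝ := fun v => 2 * (a v * a₁ v + b v * b₁ v) with hs₁def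
  have hs : ContinuousOn s (Icc x (2 * x)) := (ha.pow 2).add (hb.pow 2)
  have hs₁ : ContinuousOn s₁ (Icc x (2 * x)) := ((ha.mul ha₁).add (hb.mul hb₁)).const_smul (2:ℝ) |>.congr
    (fun v _ => by simp [hs₁def, smul_eq_mul])
  have hders : ∀ v ∈ Ioo x (2 * x), HasDerivAt s (s₁ v) v := by
    intro v hv
    have h := ((hdera v hv).fun_pow 2).add ((hderb v hv).fun_pow 2)
    exact h.congr_deriv (by simp [hs₁def]; ring)
  have hpos : ∀ v ∈ Icc x (2 * x), 0 < v := fun v hv => lt_of_lt_of_le hx hv.1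
  have hsv : ContinuousOn (fun v => s v / v) (Icc x (2 * x)) :=
    hs.div continuousOn_id (fun v hv => (hpos v hv).ne')
  have hdis : ContinuousOn (fun v => v * (a₁ v ^ 2 + b₁ v ^ 2)) (Icc x (2 * x)) :=
    continuousOn_id.mul ((ha₁.pow 2).add (hb₁.pow 2))
  have hbound : ContinuousOn (fun v => s v / v + v * (a₁ v ^ 2 + b₁ v ^ 2)) (Icc x (2 * x)) := hsv.add hdis
  have hIs : IntervalIntegrable s volume x (2 * x) := hs.intervalIntegrable_of_Icc hx2
  have hIs₁ : IntervalIntegrable s₁ volume x (2 * x) := hs₁.intervalIntegrable_of_Icc hx2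
  have hIsv : IntervalIntegrable (fun v => s v / v) volume x (2 * x) := hsv.intervalIntegrable_of_Icc hx2
  have hIdis : IntervalIntegrable (fun v => v * (a₁ v ^ 2 + b₁ v ^ 2)) volume x (2 * x) :=
    hdis.intervalIntegrable_of_Icc hx2
  have hIbound : IntervalIntegrable (fun v => s v / v + v * (a₁ v ^ 2 + b₁ v ^ 2)) volume x (2 * x) :=
    hbound.intervalIntegrable_of_Icc hx2
  have hamgm : ∀ v ∈ Icc x (2 * x), |s₁ v| ≤ s v / v + v * (a₁ v ^ 2 + b₁ v ^ 2) := by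
    intro v hv
    have hv0 : 0 < v := hpos v hv
    simp only [hs₁def, hsdef]
    rw [abs_le]
    constructor
    · have e : (a v ^ 2 + b v ^ 2) / v + v * (a₁ v ^ 2 + b₁ v ^ 2) + 2 * (a v * a₁ v + b v * b₁ v)
          = ((a v + v * a₁ v) ^ 2 + (b v + v * b₁ v) ^ 2) / v := by
        field_simp; ring
      have : 0 ≤ ((a v + v * a₁ v) ^ 2 + (b v + v * b₁ v) ^ 2) / v := by positivity
      linarith
    · have e : (a v ^ 2 + b v ^ 2) / v + v * (a₁ v ^ 2 + b₁ v ^ 2) - 2 * (a v * a₁ v + b v * b₁ v)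
          = ((a v - v * a₁ v) ^ 2 + (b v - v * b₁ v) ^ 2) / v := by
        field_simp; ring
      have : 0 ≤ ((a v - v * a₁ v) ^ 2 + (b v - v * b₁ v) ^ 2) / v := by positivity
      linarith
  have hnonneg : 0 ≤ᵐ[volume.restrict (Ioc x (2 * x))] fun v => s v / v + v * (a₁ v ^ 2 + b₁ v ^ 2) := by
    refine MeasureTheory.ae_restrict_of_forall_mem measurableSet_Ioc (fun v hv => ?_)
    have hv0 : 0 < v := lt_trans hx hv.1
    have hs0 : 0 ≤ s v := by simp only [hsdef]; positivity
    positivity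
  have habs_sub : ∀ p q : ℝ, x ≤ p → p ≤ q → q ≤ 2 * x →
      |∫ v in p..q, s₁ v| ≤ ∫ v in x..(2 * x), (s v / v + v * (a₁ v ^ 2 + b₁ v ^ 2)) := by
    intro p q hp hpq hq
    have hsubI : uIcc p q ⊆ uIcc x (2 * x) := by
      rw [uIcc_of_le hpq, uIcc_of_le hx2]; exact Icc_subset_Icc hp hq
    calc |∫ v in p..q, s₁ v| ≤ ∫ v in p..q, |s₁ v| := abs_integral_le_integral_abs hpq
      _ ≤ ∫ v in p..q, (s v / v + v * (a₁ v ^ 2 + b₁ v ^ 2)) := by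
          apply integral_mono_on hpq ((hIs₁.mono_set hsubI).abs) (hIbound.mono_set hsubI)
          intro v hv; exact hamgm v ⟨le_trans hp hv.1, le_trans hv.2 hq⟩
      _ ≤ ∫ v in x..(2 * x), (s v / v + v * (a₁ v ^ 2 + b₁ v ^ 2)) :=
          integral_mono_interval hp hpq hq hnonneg hIbound
  obtain ⟨c, hc, hcle⟩ := exists_mul_le_integral hx2 hs
  have hsc : s c ≤ 2 * ∫ v in x..(2 * x), s v / v := by
    have h1 : ∫ v in x..(2 * x), s v ≤ ∫ v in x..(2 * x), (2 * x) * (s v / v) := by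
      apply integral_mono_on hx2 hIs (hIsv.const_mul _)
      intro v hv
      have hv0 : 0 < v := hpos v hv
      have hs0 : 0 ≤ s v := by simp only [hsdef]; positivity
      rw [mul_div_assoc', le_div_iff₀ hv0]
      nlinarith [hv.2]
    rw [intervalIntegral.integral_const_mul] at h1
    have h2 : (2 * x - x) * s c = x * s c := by ring
    rw [h2] at hcle
    nlinarith [hcle, h1]
  have hFTC_le : ∀ p q : ℝ, x ≤ p → p ≤ q → q ≤ 2 * x → ∫ v in p..q, s₁ v = s q - s p := by
    intro p q hp hpq hq
    apply integral_eq_sub_of_hasDerivAt_of_le hpq (hs.mono (Icc_subset_Icc hp hq))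
    · intro v hv; exact hders v ⟨lt_of_le_of_lt hp hv.1, lt_of_lt_of_le hv.2 hq⟩
    · exact hIs₁.mono_set (by rw [uIcc_of_le hpq, uIcc_of_le hx2]; exact Icc_subset_Icc hp hq)
  have hsplit : ∫ v in x..(2 * x), (s v / v + v * (a₁ v ^ 2 + b₁ v ^ 2))
      = (∫ v in x..(2 * x), s v / v) + ∫ v in x..(2 * x), v * (a₁ v ^ 2 + b₁ v ^ 2) := integral_add hIsv hIdis
  have hkey : s z ≤ s c + ∫ v in x..(2 * x), (s v / v + v * (a₁ v ^ 2 + b₁ v ^ 2)) := by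
    rcases le_total c z with h | h
    · have h1 := hFTC_le c z hc.1 h hz.2
      have h2 := habs_sub c z hc.1 h hz.2
      have h3 := le_abs_self (∫ v in c..z, s₁ v)
      linarith
    · have h1 := hFTC_le z c hz.1 h hc.2
      have h2 := habs_sub z c hz.1 h hc.2
      have h3 := neg_abs_le (∫ v in z..c, s₁ v)
      linarith
  have : s z ≤ 3 * (∫ v in x..(2 * x), s v / v) + ∫ v in x..(2 * x), v * (a₁ v ^ 2 + b₁ v ^ 2) := by
    rw [hsplit] at hkey; linarith [hsc]
  simpa [hsdef] using this

/-! ## (X'') APPENDED (same seat, same gen): extraction on a SHORT interval with a free AM–GM parameter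

In the two-zone assembly the exterior lemma's inner datum `s(u₀)` must be extracted from `[u₀ − ℓ, u₀]` (where the Gaussian weight is
`≥ e^{−γℓ/4}E(u₀)`, i.e. with the FULL `Rc^{−A}` discount), not from the dyadic `[u₀/2, u₀]` (discount only `Rc^{−A/2}`); and the weight
on the dissipation must be a free parameter `θ` (chosen small against the layer parameter).  Hence this variant. -/

/-- **Extraction on an arbitrary interval with a free parameter.**  `0 < x < y`, `z ∈ [x,y]`, `θ > 0`; `a, b, a₁, b₁` continuous on `[x,y]`,
`a′ = a₁`, `b′ = b₁` on `(x,y)`.  Then `a(z)² + b(z)² ≤ (1/(y−x) + 1/θ)·∫_x^y (a²+b²) + θ·∫_x^y (a₁²+b₁²)`. -/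
theorem sq_le_extraction_short {x y z θ : ℝ} {a a₁ b b₁ : ℝ → ℝ} (hxy : x < y) (hz : z ∈ Icc x y) (hθ : 0 < θ)
    (ha : ContinuousOn a (Icc x y)) (hb : ContinuousOn b (Icc x y))
    (ha₁ : ContinuousOn a₁ (Icc x y)) (hb₁ : ContinuousOn b₁ (Icc x y))
    (hdera : ∀ v ∈ Ioo x y, HasDerivAt a (a₁ v) v) (hderb : ∀ v ∈ Ioo x y, HasDerivAt b (b₁ v) v) :
    a z ^ 2 + b z ^ 2
      ≤ (1 / (y - x) + 1 / θ) * (∫ v in x..y, (a v ^ 2 + b v ^ 2)) + θ * ∫ v in x..y, (a₁ v ^ 2 + b₁ v ^ 2) := by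
  have hxy' : x ≤ y := hxy.le
  have hyx : 0 < y - x := by linarith
  set s : ℝ → ℝ := fun v => a v ^ 2 + b v ^ 2 with hsdef
  set s₁ : ℝ → ℝ := fun v => 2 * (a v * a₁ v + b v * b₁ v) with hs₁def
  have hs : ContinuousOn s (Icc x y) := (ha.pow 2).add (hb.pow 2)
  have hs₁ : ContinuousOn s₁ (Icc x y) := ((ha.mul ha₁).add (hb.mul hb₁)).const_smul (2:ℝ) |>.congr
    (fun v _ => by simp [hs₁def, smul_eq_mul])
  have hders : ∀ v ∈ Ioo x y, HasDerivAt s (s₁ v) v := by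
    intro v hv
    have h := ((hdera v hv).fun_pow 2).add ((hderb v hv).fun_pow 2)
    exact h.congr_deriv (by simp [hs₁def]; ring)
  have hdis : ContinuousOn (fun v => a₁ v ^ 2 + b₁ v ^ 2) (Icc x y) := (ha₁.pow 2).add (hb₁.pow 2)
  have hbound : ContinuousOn (fun v => s v / θ + θ * (a₁ v ^ 2 + b₁ v ^ 2)) (Icc x y) :=
    (hs.div_const θ).add (continuousOn_const.mul hdis)
  have hIs : IntervalIntegrable s volume x y := hs.intervalIntegrable_of_Icc hxy'
  have hIs₁ : IntervalIntegrable s₁ volume x y := hs₁.intervalIntegrable_of_Icc hxy'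
  have hIdis : IntervalIntegrable (fun v => a₁ v ^ 2 + b₁ v ^ 2) volume x y := hdis.intervalIntegrable_of_Icc hxy'
  have hIbound : IntervalIntegrable (fun v => s v / θ + θ * (a₁ v ^ 2 + b₁ v ^ 2)) volume x y :=
    hbound.intervalIntegrable_of_Icc hxy'
  -- AM–GM: `|s′| ≤ s/θ + θ(a₁² + b₁²)`
  have hamgm : ∀ v ∈ Icc x y, |s₁ v| ≤ s v / θ + θ * (a₁ v ^ 2 + b₁ v ^ 2) := by
    intro v _
    simp only [hs₁def, hsdef]
    rw [abs_le]
    constructor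
    · have e : (a v ^ 2 + b v ^ 2) / θ + θ * (a₁ v ^ 2 + b₁ v ^ 2) + 2 * (a v * a₁ v + b v * b₁ v)
          = ((a v + θ * a₁ v) ^ 2 + (b v + θ * b₁ v) ^ 2) / θ := by
        field_simp; ring
      have : 0 ≤ ((a v + θ * a₁ v) ^ 2 + (b v + θ * b₁ v) ^ 2) / θ := by positivity
      linarith
    · have e : (a v ^ 2 + b v ^ 2) / θ + θ * (a₁ v ^ 2 + b₁ v ^ 2) - 2 * (a v * a₁ v + b v * b₁ v)
          = ((a v - θ * a₁ v) ^ 2 + (b v - θ * b₁ v) ^ 2) / θ := by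
        field_simp; ring
      have : 0 ≤ ((a v - θ * a₁ v) ^ 2 + (b v - θ * b₁ v) ^ 2) / θ := by positivity
      linarith
  have hnonneg : 0 ≤ᵐ[volume.restrict (Ioc x y)] fun v => s v / θ + θ * (a₁ v ^ 2 + b₁ v ^ 2) := by
    refine MeasureTheory.ae_restrict_of_forall_mem measurableSet_Ioc (fun v _ => ?_)
    have hs0 : 0 ≤ s v := by simp only [hsdef]; positivity
    positivity
  have habs_sub : ∀ p q : ℝ, x ≤ p → p ≤ q → q ≤ y →
      |∫ v in p..q, s₁ v| ≤ ∫ v in x..y, (s v / θ + θ * (a₁ v ^ 2 + b₁ v ^ 2)) := by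
    intro p q hp hpq hq
    have hsubI : uIcc p q ⊆ uIcc x y := by
      rw [uIcc_of_le hpq, uIcc_of_le hxy']; exact Icc_subset_Icc hp hq
    calc |∫ v in p..q, s₁ v| ≤ ∫ v in p..q, |s₁ v| := abs_integral_le_integral_abs hpq
      _ ≤ ∫ v in p..q, (s v / θ + θ * (a₁ v ^ 2 + b₁ v ^ 2)) := by
          apply integral_mono_on hpq ((hIs₁.mono_set hsubI).abs) (hIbound.mono_set hsubI)
          intro v hv; exact hamgm v ⟨le_trans hp hv.1, le_trans hv.2 hq⟩
      _ ≤ ∫ v in x..y, (s v / θ + θ * (a₁ v ^ 2 + b₁ v ^ 2)) :=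
          integral_mono_interval hp hpq hq hnonneg hIbound
  -- minimum point: `(y−x)·s(c) ≤ ∫ s`
  obtain ⟨c, hc, hcle⟩ := exists_mul_le_integral hxy' hs
  have hsc : s c ≤ 1 / (y - x) * ∫ v in x..y, s v := by
    rw [div_mul_eq_mul_div, one_mul, le_div_iff₀ hyx]
    linarith [hcle, mul_comm (y - x) (s c)]
  have hFTC_le : ∀ p q : ℝ, x ≤ p → p ≤ q → q ≤ y → ∫ v in p..q, s₁ v = s q - s p := by
    intro p q hp hpq hq
    apply integral_eq_sub_of_hasDerivAt_of_le hpq (hs.mono (Icc_subset_Icc hp hq))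
    · intro v hv; exact hders v ⟨lt_of_le_of_lt hp hv.1, lt_of_lt_of_le hv.2 hq⟩
    · exact hIs₁.mono_set (by rw [uIcc_of_le hpq, uIcc_of_le hxy']; exact Icc_subset_Icc hp hq)
  have hsplit : ∫ v in x..y, (s v / θ + θ * (a₁ v ^ 2 + b₁ v ^ 2))
      = 1 / θ * (∫ v in x..y, s v) + θ * ∫ v in x..y, (a₁ v ^ 2 + b₁ v ^ 2) := by
    rw [integral_add (hIs.div_const θ) (hIdis.const_mul θ), intervalIntegral.integral_div,
      intervalIntegral.integral_const_mul]
    ring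
  have hkey : s z ≤ s c + ∫ v in x..y, (s v / θ + θ * (a₁ v ^ 2 + b₁ v ^ 2)) := by
    rcases le_total c z with h | h
    · have h1 := hFTC_le c z hc.1 h hz.2
      have h2 := habs_sub c z hc.1 h hz.2
      have h3 := le_abs_self (∫ v in c..z, s₁ v)
      linarith
    · have h1 := hFTC_le z c hz.1 h hc.2
      have h2 := habs_sub z c hz.1 h hc.2
      have h3 := neg_abs_le (∫ v in z..c, s₁ v)
      linarith
  have : s z ≤ (1 / (y - x) + 1 / θ) * (∫ v in x..y, s v) + θ * ∫ v in x..y, (a₁ v ^ 2 + b₁ v ^ 2) := by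
    rw [hsplit] at hkey; nlinarith [hsc, hkey]
  simpa [hsdef] using this

end Summit.NavierStokesRegularity.NavierStokesRegularity.Theorems.DefectColumnGate

end
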